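import Summits.QuantumFields.YangMills.Theorems.BalabanUVNodesN07SeamWitnessCritical
import Literature.MathematicalPhysics.QuantumFieldTheory.Balaban1983to89.Node00.CriticalOnFibreTopGuarded
import Literature.MathematicalPhysics.QuantumFieldTheory.Balaban1983to89.Node00.DomainsOfSeq
import Summits.QuantumFields.YangMills.Theorems.LuscherReductionTwistedTraceScalingToronOrbit
import Literature.MathematicalPhysics.QuantumFieldTheory.Balaban1983to89.T4PairDerivBridge
import HarnessLib

/-!
v1.1 (2026-08-30, IMPORT-ONLY, every declaration byte-identical): `import …N07JunctionHsupOfSmallness` (✓140, whose closure meets the Stage-2 red set through `…OfPremisesG → K0V22ZDefs`)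
replaced by the two green Node00 modules this file actually reads names from (`CriticalOnFibreTopGuarded`: `StepGuard`; `DomainsOfSeq`: `domainsOfSeq`) — director-ym №361∕№363 cone hygiene; nothing cited from ✓140 in code.

# N07 [B11] ∕ K0⁷ chart road — THE SEAM WITNESS, part C₂: ★★★ `not_hseam` — THE DISPLAYED PREMISE HSEAM OF THE CHART ROAD IS UNINHABITED, FOR EVERY FAMILY `F`
# (director-ym №335 FINDING (B) ∕ dag-n07-e `LOCATE-HSEAM` case (γ), as a KERNEL FACT; no minimiser computed)

Cell `pub-ymgap`, seat `pub-ymgap-dag-n07-w3` g15 (WIDTH SEAT 3 on N07).  `--kind proof --supports stmt-QuantumFields-20541 --as helper` (K0⁷; count-neutral;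
NEGATIVE-SIDE helper).  [15] = [Balaban1985Variational]; [6] = [Balaban1985RegularSpaces]; [III] = [Balaban1988Convergent]; [I] = [Balaban1987RG1]; [II] = [Balaban1984PropagatorsII].

HSEAM (the binder `hseam` of ✓p764312 `…N07JunctionHsupOfSmallness.prop8StepCoPGridGAt_of_seam`, VERBATIM below; = ✓125 :78–90, ✓134′ :306–324) says: for every step guard, every
(2.18) index `s`, every small datum `W`, every `U` agreeing with `W` on the record's determining set and CRITICAL ON THE RECORD's FIBRE (`IsCritOnFibre … (genSet s.Ω k) W U`,
reading (b): all bonds MEETING `Γ_j`), the Wilson action is stationary along EVERY differentiable curve through `U` keeping only [II] (2.3)'s `Λ_j`-averages (`Domains.LamBond`).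
THE WITNESS (all `F`; `N = 2`, `K = k = 1`): dag-n21-c's one-cube index (`Ω₁ = Λ₁ = B(0)`, `M = 1`, `g ≡ 1`, `exists_seq_singleCube`; separation vacuous), `Adm := ⊤`,
`ν := numerics7OfRecord₁₂` (`M₁ = 1`), `δ := 3` (the (7)-smallness `DataSmall7PTop` is void: `dist1 ≤ 2`), `U :=` the exterior diagonal twist `(diagSU2 1 on ⟨π(−1,−1,0,0), 0⟩)`
(part C₁: (b)-critical by Fermat, for its own averages `W := M_𝐁(U)`), and the curve `γ_t := (diagSU2 t on ⟨π(−1,0,0,0), 0⟩)·(diagSU2 (−t) on ⟨π(−1,1,0,0), 0⟩)·U` — two parallel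
inward connectors of the face `x₀ = 0` of `B(0)`, twisted antisymmetrically.  Along `γ`: the level-0 `Λ₀`-bonds (both ends outside `Ω₁`) are untouched (the connectors end in
`B(0) = Ω₁`, a DEEP block); every average of record of level `≥ 1` is CONSTANT (part B `iter_twist_eq`: at the crossed coarse bond the printed `exp[mean log]` of the loop family
`{diagSU2 t ×L·(4!)², diagSU2(−t) ×L·(4!)², 1 …}` is exactly `1`, parts A∕A′); levels `≥ 2` carry no `Λ_j`-bond anyway (`Ω_j = ∅`).  But the corner plaquette
`p₀ = ⟨π(−1,−1,0,0); 0, 1⟩` reads `diagSU2 (1 − t)` and every other plaquette through the connectors is flat at `t = 0`, so `t ↦ A(γ_t)` has derivative `−sin 1 ≠ 0` at `0` (§2).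
HSEAM would force `−sin 1 = 0`.  ★★★ `not_hseam` (§3); COROLLARY `prop8StepCoPGridGAt_of_seam_vacuous`: ✓140's closing theorem has an uninhabited hypothesis — the K0⁷ chart road
AS TYPED cannot close stub 1 (the repair is (E1)'s datum correction or (E3), director-ym №335 (B)(C); this file decides nothing between them).

HONEST FRAMING: a count-neutral NEGATIVE-SIDE certificate about the TREE's own displayed binder (the (b)∕(2.3) seam); nothing of Bałaban [15]∕[6]∕[III]∕[I]∕[II] asserted or refuted
(print's Prop. 8 concerns the (2.3)-fibre, on which `U` above is NOT critical — consistent); K0⁷ stub 1 NOT closed and NOT refuted (its registered text is not HSEAM); `HThm4Rec*`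
UNDISCHARGED; N05 ∕ N07 NOT discharged; counts unmoved (typed 28∕28 · discharged 8∕28; the chair's line is the only count); one finite 𝕋⁴ programme at fixed ε — R4 closes the
conditional finite-𝕋⁴ rung `BalabanLadder.UV` only; the YM mass gap (Clay) is NOT proved by any of this; nothing continuum ∕ ℝ⁴ ∕ OS.  No `def`, no `instance`, no `notation`, no `sorry`.

References: [15] (5)–(6) p. 278, Prop. 8 p. 304, (147)–(153) p. 301; [6] (1.3)–(1.6) p. 77, Prop. 8 p. 100; [III] (2.1)–(2.5) pp. 254–255, (2.10)–(2.12) p. 256, (2.18) p. 257;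
[I] (0.1)–(0.4) pp. 251–253; [II] (2.3) p. 224.
-/

set_option autoImplicit false

noncomputable section

open scoped Matrix.Norms.L2Operator BigOperators Topology

namespace Summit.QuantumFields.YangMills.BalabanUVNodes.N07SeamWitness

open Filter
open Literature.MathematicalPhysics.QuantumFieldTheory.Balaban1983to89
open Literature.MathematicalPhysics.QuantumFieldTheory.Balaban1983to89.Node00
open Literature.MathematicalPhysics.QuantumFieldTheory.Balaban1983to89.T4Continuum
open B15Eq112TorusCover B14DomainGeom B15DeterminingSets B15LatticeCubeTorus BlockAveraging
open B6SectADomainsV1 (Domains)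
open B5Eq118OneStroke (iterBlockOf iterBlockOf_zero iterBlockOf_succ)
open ExpMeanLog (deltaSU expMeanLogSU deltaSU_pos)
open Summit.QuantumFields.YangMills.Theorems.FemtoTransferGap (diagSU2)
open Summit.QuantumFields.YangMills.Theorems.FemtoTransferGap.TwoLattice.Toron (coe_diagSU2 diagSU2_add diagSU2_zero diagSU2_neg)
open Summit.QuantumFields.YangMills.Theorems.K0BgProvisoOverRange (shift_cover)
open Summit.QuantumFields.YangMills.Theorems.K0VariationalThm1ScaledCorner (exists_seq_singleCube lt_sitesPerDir_zero)
open T4PairDerivBridge (dist1_le_two_specialUnitaryGroup)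

/-! ## §1  The diagonal one-parameter subgroup of `SU(2)` (the Femto∕Toron lane's `diagSU2`, by name): trace, smoothness, smallness near `0` -/
section Diag

/-- `Re tr ∕ 2` of `diag(e^{iφ}, e^{−iφ})` is `cos φ`. [folklore] -/
theorem reTr_diagSU2 (φ : ℝ) : reTr (diagSU2 φ) = Real.cos φ := by
  show (Matrix.trace ((diagSU2 φ : Matrix.specialUnitaryGroup (Fin 2) ℂ) : Matrix (Fin 2) (Fin 2) ℂ)).re / Fintype.card (Fin 2) = Real.cos φ
  rw [coe_diagSU2, Matrix.trace_fin_two_of, Complex.add_re, Fintype.card_fin]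
  rw [show -((φ : ℂ) * Complex.I) = ((-φ : ℝ) : ℂ) * Complex.I by push_cast; ring, Complex.exp_ofReal_mul_I_re, Complex.exp_ofReal_mul_I_re,
    Real.cos_neg]
  push_cast
  ring

/-- The matrix of `diagSU2 t` is a differentiable function of `t`. [folklore] -/
theorem differentiable_coe_diagSU2 : Differentiable ℝ (fun t : ℝ => ((diagSU2 t : Matrix.specialUnitaryGroup (Fin 2) ℂ) : Matrix (Fin 2) (Fin 2) ℂ)) := by
  have h : (fun t : ℝ => ((diagSU2 t : Matrix.specialUnitaryGroup (Fin 2) ℂ) : Matrix (Fin 2) (Fin 2) ℂ)) =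
      fun t : ℝ => !![Complex.exp ((t : ℂ) * Complex.I), 0; 0, Complex.exp (-((t : ℂ) * Complex.I))] := funext fun t => coe_diagSU2 t
  rw [h]
  refine differentiable_pi.2 fun i => differentiable_pi.2 fun j => ?_
  have h1 : Differentiable ℝ (fun t : ℝ => Complex.exp (t * Complex.I)) :=
    Complex.differentiable_exp.comp ((Complex.ofRealCLM.differentiable).mul_const Complex.I)
  have h2 : Differentiable ℝ (fun t : ℝ => Complex.exp (-(t * Complex.I))) :=
    Complex.differentiable_exp.comp ((Complex.ofRealCLM.differentiable).mul_const Complex.I).neg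
  fin_cases i <;> fin_cases j <;> simp [h1, h2]

/-- The matrix of `diagSU2 (−t)` is a differentiable function of `t`. [folklore] -/
theorem differentiable_coe_diagSU2_neg : Differentiable ℝ (fun t : ℝ => ((diagSU2 (-t) : Matrix.specialUnitaryGroup (Fin 2) ℂ) : Matrix (Fin 2) (Fin 2) ℂ)) :=
  differentiable_coe_diagSU2.comp differentiable_neg

/-- Near `t = 0` the element `diagSU2 t` is within `δ₂` of `1` (continuity at `diagSU2 0 = 1`). [folklore] -/
theorem eventually_dist1_diagSU2_lt : ∀ᶠ t in 𝓝 (0 : ℝ), dist1 (diagSU2 t) < deltaSU (Fin 2) := by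
  have hc : Continuous (fun t : ℝ => dist1 (diagSU2 t)) := by
    show Continuous (fun t : ℝ => ‖((diagSU2 t : Matrix.specialUnitaryGroup (Fin 2) ℂ) : Matrix (Fin 2) (Fin 2) ℂ) - 1‖)
    exact (differentiable_coe_diagSU2.continuous.sub continuous_const).norm
  have h0 : dist1 (diagSU2 0) = 0 := by rw [diagSU2_zero, GaugeGroup.dist1_one]
  have := hc.tendsto 0
  rw [h0] at this
  exact this.eventually (gt_mem_nhds deltaSU_pos)

end Diag

/-! ## §2  The curve `t ↦ γ_t` (two-connector twist of the exterior diagonal twist): smoothness and `(A ∘ γ)′(0) = −sin θ` -/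
section Curve

variable {P : Params}

/-- **THE CURVE IS DIFFERENTIABLE AS A CURVE OF BOND MATRICES** (each bond reads a constant, `diagSU2 t` or `diagSU2 (−t)`). [cite: Balaban1985Variational, (5) p.278 (bookkeeping)] -/
theorem differentiable_twist {μ0 ν₁ : Fin P.d} (θ : ℝ) :
    Differentiable ℝ (fun (t : ℝ) (b : PBond P 0) =>
      (((if b.src = (cover P (fun i => if i = μ0 ∨ i = ν₁ then (-1 : ℤ) else 0)).shift ν₁ ∧ b.dir = μ0 then diagSU2 t else 1) *
        (if b.src = ((cover P (fun i => if i = μ0 ∨ i = ν₁ then (-1 : ℤ) else 0)).shift ν₁).shift ν₁ ∧ b.dir = μ0 then (diagSU2 t)⁻¹ else 1) *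
        (if b.src = cover P (fun i => if i = μ0 ∨ i = ν₁ then (-1 : ℤ) else 0) ∧ b.dir = μ0 then diagSU2 θ else 1) : Matrix.specialUnitaryGroup (Fin 2) ℂ) :
        Matrix (Fin 2) (Fin 2) ℂ)) := by
  refine differentiable_pi.2 fun b => ?_
  simp only [Submonoid.coe_mul]
  refine (Differentiable.mul ?_ ?_).mul ?_
  · by_cases h : b.src = (cover P (fun i => if i = μ0 ∨ i = ν₁ then (-1 : ℤ) else 0)).shift ν₁ ∧ b.dir = μ0
    · simp only [h, and_self, if_true]; exact differentiable_coe_diagSU2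
    · simp only [h, if_false]; exact differentiable_const _
  · by_cases h : b.src = ((cover P (fun i => if i = μ0 ∨ i = ν₁ then (-1 : ℤ) else 0)).shift ν₁).shift ν₁ ∧ b.dir = μ0
    · simp only [h, and_self, if_true, ← diagSU2_neg]; exact differentiable_coe_diagSU2_neg
    · simp only [h, if_false]; exact differentiable_const _
  · exact differentiable_const _

/-- **`(A ∘ γ)′(0) = −sin θ`**: the corner plaquette `p₀` reads `diagSU2 (θ − t)` (`Re tr ∕ 2 = cos(θ − t)`), every other plaquette term is minimal at `t = 0` (part C₁'s dichotomy:
it is `U`'s term, or `U`'s term is `0`), so the remainder has a local minimum and zero derivative at `0` (Fermat), and the derivative of the action is that of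
`t ↦ 1 − cos(θ − t)`.  (Period `> 3`, `μ₀ < ν₁`.) [cite: Balaban1985Variational, (5) p.278; Balaban1987RG1, (0.2) p.252 (bookkeeping)] -/
theorem hasDerivAt_wilsonAction4_twist (hS3 : 3 < P.sitesPerDir 0) {μ0 ν₁ : Fin P.d} (hne : ν₁ ≠ μ0) (hμν : μ0 < ν₁) (θ : ℝ) :
    HasDerivAt (fun t : ℝ => wilsonAction4 (fun b : PBond P 0 =>
      ((if b.src = (cover P (fun i => if i = μ0 ∨ i = ν₁ then (-1 : ℤ) else 0)).shift ν₁ ∧ b.dir = μ0 then diagSU2 t else 1) *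
        (if b.src = ((cover P (fun i => if i = μ0 ∨ i = ν₁ then (-1 : ℤ) else 0)).shift ν₁).shift ν₁ ∧ b.dir = μ0 then (diagSU2 t)⁻¹ else 1) *
        (if b.src = cover P (fun i => if i = μ0 ∨ i = ν₁ then (-1 : ℤ) else 0) ∧ b.dir = μ0 then diagSU2 θ else 1) : Matrix.specialUnitaryGroup (Fin 2) ℂ)))
      (-Real.sin θ) 0 := by
  classical
  set x : Site P 0 := cover P (fun i => if i = μ0 ∨ i = ν₁ then (-1 : ℤ) else 0) with hx
  set U : GaugeField P 0 (Matrix.specialUnitaryGroup (Fin 2) ℂ) := fun b => if b.src = x ∧ b.dir = μ0 then diagSU2 θ else 1 with hU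
  set V : ℝ → GaugeField P 0 (Matrix.specialUnitaryGroup (Fin 2) ℂ) := fun t b =>
    (if b.src = x.shift ν₁ ∧ b.dir = μ0 then diagSU2 t else 1) * (if b.src = (x.shift ν₁).shift ν₁ ∧ b.dir = μ0 then (diagSU2 t)⁻¹ else 1) * U b with hV
  set p₀ : Plaq P 0 := ⟨x, μ0, ν₁, hμν⟩ with hp₀
  show HasDerivAt (fun t => wilsonAction4 (V t)) (-Real.sin θ) 0
  -- `V 0 = U`
  have hV0 : V 0 = U := by
    funext b
    simp only [hV, diagSU2_zero, inv_one]
    rw [ite_self, ite_self, one_mul, one_mul]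
  -- the action as a sum of plaquette terms, the corner term split off
  set s : ℝ → Plaq P 0 → ℝ := fun t p => 1 - reTr (GaugeField.plaqHol (V t) p) with hs
  have hS : ∀ t, wilsonAction4 (V t) = s t p₀ + ∑ p ∈ Finset.univ.erase p₀, s t p := by
    intro t
    unfold wilsonAction4 wilsonAction
    simp only [one_mul]
    rw [← Finset.add_sum_erase _ _ (Finset.mem_univ p₀)]
  -- the corner term
  have hcorner : ∀ t, s t p₀ = 1 - Real.cos (θ - t) := by
    intro t
    simp only [hs]
    rw [show GaugeField.plaqHol (V t) p₀ = diagSU2 θ * (diagSU2 t)⁻¹ from plaqHol_twist_corner hS3 hne hμν (diagSU2 t) (diagSU2 θ),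
      ← diagSU2_neg, ← diagSU2_add, ← sub_eq_add_neg, reTr_diagSU2]
  have hf : HasDerivAt (fun t => s t p₀) (-Real.sin θ) 0 := by
    rw [show (fun t => s t p₀) = fun t => 1 - Real.cos (θ - t) from funext hcorner]
    have h1 : HasDerivAt (fun t : ℝ => θ - t) (-1) 0 := by simpa using (hasDerivAt_id (0 : ℝ)).const_sub θ
    have h2 := (h1.cos).const_sub 1
    refine h2.congr_deriv ?_
    simp
  -- the remainder has a local minimum at `0`
  set R : ℝ → ℝ := fun t => ∑ p ∈ Finset.univ.erase p₀, s t p with hR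
  have hRmin : IsLocalMin R 0 := by
    refine Filter.Eventually.of_forall fun t => ?_
    show R 0 ≤ R t
    refine Finset.sum_le_sum fun p hp => ?_
    have hp' : p ≠ p₀ := (Finset.mem_erase.1 hp).1
    simp only [hs, hV0]
    rcases plaqHol_twist_dichotomy hS3 hne hμν (diagSU2 t) (diagSU2 θ) p hp' with h | h
    · show 1 - reTr (GaugeField.plaqHol U p) ≤ 1 - reTr (GaugeField.plaqHol (V t) p)
      rw [show GaugeField.plaqHol (V t) p = GaugeField.plaqHol U p from h]
    · show 1 - reTr (GaugeField.plaqHol U p) ≤ 1 - reTr (GaugeField.plaqHol (V t) p)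
      rw [show GaugeField.plaqHol U p = 1 from h, GaugeGroup.reTr_one]
      linarith [GaugeGroup.reTr_le_one (GaugeField.plaqHol (V t) p)]
  -- differentiability of the action along the curve, hence of the remainder
  have hA : DifferentiableAt ℝ (fun t => wilsonAction4 (V t)) 0 :=
    differentiableAt_wilsonAction4_along ((differentiable_twist (P := P) (μ0 := μ0) (ν₁ := ν₁) θ) 0)
  have hRdef : R = fun t => wilsonAction4 (V t) - s t p₀ := by
    funext t; rw [hS t]; ring
  have hRd : DifferentiableAt ℝ R 0 := by
    rw [hRdef]; exact hA.sub hf.differentiableAt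
  have hR0 : HasDerivAt R 0 0 := by
    have := hRd.hasDerivAt
    rwa [hRmin.deriv_eq_zero] at this
  -- assemble
  have hsum := hf.add hR0
  rw [add_zero] at hsum
  refine hsum.congr_of_eventuallyEq (Filter.Eventually.of_forall fun t => ?_)
  show wilsonAction4 (V t) = s t p₀ + R t
  exact hS t

end Curve

/-! ## §3  ★★★ HSEAM is uninhabited -/
section NotInhabited

open T4Continuum (T4Family)

/-- **★★★ THE DISPLAYED PREMISE HSEAM OF THE K0⁷ CHART ROAD IS UNINHABITED, FOR EVERY FAMILY `F`** (the binder `hseam` of ✓`…N07JunctionHsupOfSmallness.prop8StepCoPGridGAt_of_seam`,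
VERBATIM).  Witness: `K = k = 1`, dag-n21-c's one-cube index (`Ω₁ = B(0)`), `Adm := ⊤`, `ν := numerics7OfRecord₁₂`, `δ := 3`, `U :=` the exterior diagonal twist by `diagSU2 1`,
`W := M_𝐁(U)` — `U` is (b)-critical (part C₁ `isCritOnFibre_extTwist`, Fermat, no minimiser) — and the antisymmetric two-connector curve `γ`, along which every [II] (2.3)
`Λ_j`-average is constant (level 0: the connectors end in the deep block `B(0)`; levels `≥ 1`: part B `iter_twist_eq`) while `(A ∘ γ)′(0) = −sin 1 ≠ 0` (§2).  So «(b)-critical ⇒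
stationary along every (2.3)-admissible curve» FAILS: director-ym №335 FINDING (B) ∕ dag-n07-e `LOCATE-HSEAM` case (γ) as a kernel fact.
[cite: Balaban1985Variational, (5)–(6) p.278, Prop. 8 p.304; Balaban1984PropagatorsII, (2.3) p.224; Balaban1988Convergent, (2.2) p.255, (2.10)–(2.12) p.256; Balaban1987RG1, (0.4) p.253] -/
theorem not_hseam (F : T4Family) :
    ¬ (∀ (Adm : StepGuard F), ∀ (ν : Stage7Numerics) (M : ℕ) (g : ℕ → ℝ) (K k : ℕ) (s : SeqOfRecord F ν M g K k), Sect2.SeqSeparated ν.M₁ s → 0 < ν.M₁ →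
        Adm ν M g K k s → 1 ≤ k →
        ∀ (δ : ℕ → ℝ),
        ∀ W : MSField (F.P K) (SU 2), Sect2.DataSmall7PTop (avOfRecord F 2 K) s.Ω (suppDomOfRecord F ν K s.Ω) k δ W →
        ∀ U : GaugeField (F.P K) 0 (SU 2),
        AgreeOn (genSet s.Ω k) (avgFamily (avOfRecord F 2 K) U) W → IsCritOnFibre F 2 K (genSet s.Ω k) W U →
        ∀ (hkk : k ≤ (F.P K).m + (F.P K).K),
        ∀ γ : ℝ → GaugeField (F.P K) 0 (SU 2), γ 0 = U →
          DifferentiableAt ℝ (fun (t : ℝ) (b : PBond (F.P K) 0) => ((γ t b : SU 2) : Matrix (Fin 2) (Fin 2) ℂ)) 0 →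
            (∀ᶠ t in nhds (0 : ℝ), ∀ (j : ℕ) (c : PBond (F.P K) j), (domainsOfSeq s.Ω k hkk).LamBond j c →
              avgFamily (avOfRecord F 2 K) (γ t) j c = W j c) →
              ∀ a : ℝ, HasDerivAt (fun t => wilsonAction4 (γ t)) a 0 → a = 0) := by
  intro hseam
  classical
  -- the torus `F.P 1`
  have hPL : (F.P 1).L = F.L := T4Family.P_L F 1
  have hPd : (F.P 1).d = 4 := T4Family.P_d F 1
  have hL11 : 11 < F.L := F.hL11
  have hsites : (F.P 1).sitesPerDir 0 = 2 * F.L ^ (F.m + 1) := T4Family.sitesPerDir_eq F 1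
  have hper2 : 2 * (F.P 1).L < (F.P 1).sitesPerDir 0 := by
    rw [hsites, hPL]
    have : F.L < F.L ^ (F.m + 1) := by
      calc F.L = F.L ^ 1 := (pow_one _).symm
        _ < F.L ^ (F.m + 1) := Nat.pow_lt_pow_right (by omega) (by have := F.hm; omega)
    omega
  have hL3 : 3 ≤ (F.P 1).L := by rw [hPL]; omega
  have hS3 : 3 < (F.P 1).sitesPerDir 0 := by omega
  have hS : ((F.P 1).L : ℤ) + 2 ≤ (F.P 1).sitesPerDir 0 := by
    have : (F.P 1).L + 2 ≤ (F.P 1).sitesPerDir 0 := by omega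
    exact_mod_cast this
  have hj : 0 + 1 ≤ (F.P 1).m + (F.P 1).K := by rw [T4Family.P_m, T4Family.P_K]; have := F.hm; omega
  have hkk : 1 ≤ (F.P 1).m + (F.P 1).K := by rw [T4Family.P_m, T4Family.P_K]; have := F.hm; omega
  -- directions `0 < 1`, `2`
  have h0d : 0 < (F.P 1).d := by rw [hPd]; norm_num
  have h1d : 1 < (F.P 1).d := by rw [hPd]; norm_num
  have h2d : 2 < (F.P 1).d := by rw [hPd]; norm_num
  have hνμ : (⟨1, h1d⟩ : Fin (F.P 1).d) ≠ ⟨0, h0d⟩ := by intro h; have := congrArg Fin.val h; simp at this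
  have hκμ : (⟨2, h2d⟩ : Fin (F.P 1).d) ≠ ⟨0, h0d⟩ := by intro h; have := congrArg Fin.val h; simp at this
  have hκν : (⟨2, h2d⟩ : Fin (F.P 1).d) ≠ ⟨1, h1d⟩ := by intro h; have := congrArg Fin.val h; simp at this
  have hμν : (⟨0, h0d⟩ : Fin (F.P 1).d) < ⟨1, h1d⟩ := Fin.mk_lt_mk.2 (by norm_num)
  -- the index `k = 1`, `Ω₁ = Λ₁ = B(0)`
  obtain ⟨s, hsΩ, hsep⟩ := exists_seq_singleCube F numerics7OfRecord₁₂ 1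
  have hsΩ' : s.Ω 1 = cubeEnl (F.P 1) (F.P 1).L 0 0 := by rw [hsΩ, hPL]
  -- the half block size
  set hh : ℕ := ((F.P 1).L - 1) / 2 with hhh
  have hL2 : 2 * hh + 1 = (F.P 1).L := AveragingRT.two_mul_half_add_one (F.P 1)
  have hemb0 : ∀ κ, emb (0 : Site (F.P 1) 1) κ = ((hh : ℕ) : ZMod ((F.P 1).sitesPerDir 0)) := by
    intro κ
    show (((((0 : Site (F.P 1) 1) κ).val * (F.P 1).L + ((F.P 1).L - 1) / 2 : ℕ)) : ZMod ((F.P 1).sitesPerDir 0)) = _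
    rw [Site.zero_apply, ZMod.val_zero, zero_mul, zero_add]
  -- the two connectors end in the block `B(0)`: coordinates of `x = π(−1,−1,0,0)`, `x + e₁`, `x + 2e₁`, then of their `e₀`-translates
  have hA : ∀ κ, cover (F.P 1) (fun i => if i = (⟨0, h0d⟩ : Fin (F.P 1).d) ∨ i = ⟨1, h1d⟩ then (-1 : ℤ) else 0) κ =
      if κ = ⟨0, h0d⟩ ∨ κ = ⟨1, h1d⟩ then (-1 : ZMod ((F.P 1).sitesPerDir 0)) else 0 := by
    intro κ
    rw [cover_apply]
    by_cases h : κ = ⟨0, h0d⟩ ∨ κ = ⟨1, h1d⟩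
    · simp only [h, if_true]; push_cast; ring
    · simp only [h, if_false]; push_cast; ring
  have hA1 : ∀ κ, ((cover (F.P 1) (fun i => if i = (⟨0, h0d⟩ : Fin (F.P 1).d) ∨ i = ⟨1, h1d⟩ then (-1 : ℤ) else 0)).shift ⟨1, h1d⟩) κ =
      if κ = ⟨0, h0d⟩ then (-1 : ZMod ((F.P 1).sitesPerDir 0)) else 0 := by
    intro κ
    rw [Site.shift_apply, hA, hA]
    by_cases h1 : κ = ⟨1, h1d⟩
    · rw [if_pos h1, if_pos (Or.inr rfl), if_neg (h1 ▸ hνμ)]; ring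
    · rw [if_neg h1]
      by_cases h0 : κ = ⟨0, h0d⟩
      · rw [if_pos (Or.inl h0), if_pos h0]
      · rw [if_neg (by push Not; exact ⟨h0, h1⟩), if_neg h0]
  have hA2 : ∀ κ, (((cover (F.P 1) (fun i => if i = (⟨0, h0d⟩ : Fin (F.P 1).d) ∨ i = ⟨1, h1d⟩ then (-1 : ℤ) else 0)).shift ⟨1, h1d⟩).shift ⟨1, h1d⟩) κ =
      if κ = ⟨0, h0d⟩ then (-1 : ZMod ((F.P 1).sitesPerDir 0)) else if κ = ⟨1, h1d⟩ then 1 else 0 := by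
    intro κ
    rw [Site.shift_apply, hA1, hA1, if_neg hνμ]
    by_cases h1 : κ = ⟨1, h1d⟩
    · rw [if_pos h1, if_neg (h1 ▸ hνμ), if_pos h1]; ring
    · rw [if_neg h1, if_neg h1]
  have htgt1 : blockOf (((cover (F.P 1) (fun i => if i = (⟨0, h0d⟩ : Fin (F.P 1).d) ∨ i = ⟨1, h1d⟩ then (-1 : ℤ) else 0)).shift ⟨1, h1d⟩).shift ⟨0, h0d⟩)
      = 0 := by
    refine blockOf_eq_of_near_emb hj _ _ (fun _ => -(hh : ℤ)) (fun κ => ?_) (fun κ => ⟨le_rfl, by omega⟩)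
    rw [hemb0, Site.shift_apply, hA1, hA1, if_pos rfl]
    by_cases h0 : κ = ⟨0, h0d⟩
    · rw [if_pos h0]; push_cast; ring
    · rw [if_neg h0, if_neg h0]; push_cast; ring
  have htgt2 : blockOf ((((cover (F.P 1) (fun i => if i = (⟨0, h0d⟩ : Fin (F.P 1).d) ∨ i = ⟨1, h1d⟩ then (-1 : ℤ) else 0)).shift ⟨1, h1d⟩).shift ⟨1, h1d⟩).shift
      ⟨0, h0d⟩) = 0 := by
    refine blockOf_eq_of_near_emb hj _ _ (fun κ => if κ = ⟨1, h1d⟩ then 1 - (hh : ℤ) else -(hh : ℤ)) (fun κ => ?_) (fun κ => ?_)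
    · rw [hemb0, Site.shift_apply, hA2, hA2, if_pos rfl]
      by_cases h0 : κ = ⟨0, h0d⟩
      · rw [if_pos h0, if_neg (h0 ▸ Ne.symm hνμ)]; push_cast; ring
      · rw [if_neg h0, if_neg h0]
        by_cases h1 : κ = ⟨1, h1d⟩
        · rw [if_pos h1, if_pos h1]; push_cast; ring
        · rw [if_neg h1, if_neg h1]; push_cast; ring
    · by_cases h1 : κ = ⟨1, h1d⟩
      · rw [if_pos h1]; constructor <;> omega
      · rw [if_neg h1]; constructor <;> omega
  -- every fine site of the block `B(0)` lies in `Ω₁`, so the block `0` is deep at level 0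
  have hdeep0 : (0 : Site (F.P 1) 1) ∈ (domainsOfSeq s.Ω 1 hkk).Om 1 := by
    rw [mem_domainsOfSeq_Om_iff s.Ω hkk le_rfl]
    intro z hz i hi1 hi2
    obtain rfl : i = 1 := le_antisymm hi2 hi1
    rw [hsΩ']
    apply mem_cubeEnl_zero_of_blockOf_eq_zero hj
    simpa [iterBlockOf_succ, iterBlockOf_zero] using hz
  -- the data of the witness
  have hsmall : Sect2.DataSmall7PTop (avOfRecord F 2 1) s.Ω (suppDomOfRecord F numerics7OfRecord₁₂ 1 s.Ω) 1 (fun _ => (3 : ℝ))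
      (avgFamily (avOfRecord F 2 1) (fun b : PBond (F.P 1) 0 =>
        if b.src = cover (F.P 1) (fun i => if i = (⟨0, h0d⟩ : Fin (F.P 1).d) ∨ i = ⟨1, h1d⟩ then (-1 : ℤ) else 0) ∧ b.dir = ⟨0, h0d⟩ then diagSU2 1 else 1)) := by
    refine ⟨fun p _ => lt_of_le_of_lt (dist1_le_two_specialUnitaryGroup _) (by norm_num), fun m _ p _ => ?_⟩
    exact lt_of_le_of_lt (dist1_le_two_specialUnitaryGroup _) (by norm_num)
  -- apply HSEAM to the witness
  have h0 := hseam (fun _ _ _ _ _ _ => True) numerics7OfRecord₁₂ 1 (fun _ => (1 : ℝ)) 1 1 s hsep (by show (0 : ℕ) < 1; exact Nat.one_pos) trivial le_rfl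
    (fun _ => (3 : ℝ)) _ hsmall _ (fun _ _ _ => rfl)
    (isCritOnFibre_extTwist F 2 1 hS s.Ω hsΩ' hνμ (diagSU2 1)) hkk
    (fun t b => (if b.src = (cover (F.P 1) (fun i => if i = (⟨0, h0d⟩ : Fin (F.P 1).d) ∨ i = ⟨1, h1d⟩ then (-1 : ℤ) else 0)).shift ⟨1, h1d⟩ ∧ b.dir = ⟨0, h0d⟩
        then diagSU2 t else 1) *
      (if b.src = ((cover (F.P 1) (fun i => if i = (⟨0, h0d⟩ : Fin (F.P 1).d) ∨ i = ⟨1, h1d⟩ then (-1 : ℤ) else 0)).shift ⟨1, h1d⟩).shift ⟨1, h1d⟩ ∧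
          b.dir = ⟨0, h0d⟩ then (diagSU2 t)⁻¹ else 1) *
      (if b.src = cover (F.P 1) (fun i => if i = (⟨0, h0d⟩ : Fin (F.P 1).d) ∨ i = ⟨1, h1d⟩ then (-1 : ℤ) else 0) ∧ b.dir = ⟨0, h0d⟩ then diagSU2 1 else 1))
    (by
      funext b
      simp only [diagSU2_zero, inv_one]
      rw [ite_self, ite_self, one_mul, one_mul])
    ((differentiable_twist (P := F.P 1) (μ0 := ⟨0, h0d⟩) (ν₁ := ⟨1, h1d⟩) 1) 0)
    (by
      filter_upwards [eventually_dist1_diagSU2_lt] with t ht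
      intro j c hjc
      rcases j with _ | j
      · -- level 0: the curve moves only the two connectors, whose far ends are deep
        show _ = (if c.src = _ ∧ c.dir = _ then diagSU2 1 else 1)
        by_contra hne'
        have hc' : (c.src = (cover (F.P 1) (fun i => if i = (⟨0, h0d⟩ : Fin (F.P 1).d) ∨ i = ⟨1, h1d⟩ then (-1 : ℤ) else 0)).shift ⟨1, h1d⟩ ∧
              c.dir = ⟨0, h0d⟩) ∨
            (c.src = ((cover (F.P 1) (fun i => if i = (⟨0, h0d⟩ : Fin (F.P 1).d) ∨ i = ⟨1, h1d⟩ then (-1 : ℤ) else 0)).shift ⟨1, h1d⟩).shift ⟨1, h1d⟩ ∧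
              c.dir = ⟨0, h0d⟩) := by
          by_contra hcon
          push Not at hcon
          apply hne'
          show (if _ then diagSU2 t else 1) * (if _ then (diagSU2 t)⁻¹ else 1) * _ = _
          rw [if_neg (fun h => hcon.1 h.1 h.2), if_neg (fun h => hcon.2 h.1 h.2), one_mul, one_mul]
        have hdeep : (domainsOfSeq s.Ω 1 hkk).Deep 0 c.tgt := by
          show blockOf (c.src.shift c.dir) ∈ (domainsOfSeq s.Ω 1 hkk).Om 1
          rcases hc' with ⟨h1, h2⟩ | ⟨h1, h2⟩
          · rw [h1, h2, htgt1]; exact hdeep0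
          · rw [h1, h2, htgt2]; exact hdeep0
        exact hjc.2.2 hdeep
      · -- levels `≥ 1`: every average of record is constant along the curve
        exact congrFun (iter_twist_eq (avOfRecord F 2 1) rfl hj hL3 hper2 hνμ hκμ hκν (diagSU2 t) (diagSU2 1) ht (j + 1) (by omega)) c)
    (-Real.sin 1) (hasDerivAt_wilsonAction4_twist hS3 hνμ hμν 1)
  have hsin : 0 < Real.sin 1 := Real.sin_pos_of_pos_of_lt_pi one_pos (by linarith [Real.pi_gt_three])
  linarith

/-- **COROLLARY: ✓140's closing theorem `prop8StepCoPGridGAt_of_seam` has an UNINHABITED hypothesis** — the K0⁷ chart road AS TYPED (stub 1 ⟸ HSEAM alone) cannot be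
walked to its end: any proof of the registered stub-1 text must come from a corrected determining-set datum ((E1)) or from new mathematics for the over-constrained problem
((E3)), director-ym №335 (B)(C) — this file decides nothing between them and refutes no registered statement. [cite: Balaban1985Variational, Prop. 8 p.304; Balaban1985RegularSpaces, Prop. 8 p.100 (bookkeeping)] -/
theorem hseam_hypothesis_uninhabited (F : T4Family)
    (hseam : ∀ (Adm : StepGuard F), ∀ (ν : Stage7Numerics) (M : ℕ) (g : ℕ → ℝ) (K k : ℕ) (s : SeqOfRecord F ν M g K k), Sect2.SeqSeparated ν.M₁ s → 0 < ν.M₁ →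
        Adm ν M g K k s → 1 ≤ k →
        ∀ (δ : ℕ → ℝ),
        ∀ W : MSField (F.P K) (SU 2), Sect2.DataSmall7PTop (avOfRecord F 2 K) s.Ω (suppDomOfRecord F ν K s.Ω) k δ W →
        ∀ U : GaugeField (F.P K) 0 (SU 2),
        AgreeOn (genSet s.Ω k) (avgFamily (avOfRecord F 2 K) U) W → IsCritOnFibre F 2 K (genSet s.Ω k) W U →
        ∀ (hkk : k ≤ (F.P K).m + (F.P K).K),
        ∀ γ : ℝ → GaugeField (F.P K) 0 (SU 2), γ 0 = U →
          DifferentiableAt ℝ (fun (t : ℝ) (b : PBond (F.P K) 0) => ((γ t b : SU 2) : Matrix (Fin 2) (Fin 2) ℂ)) 0 →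
            (∀ᶠ t in nhds (0 : ℝ), ∀ (j : ℕ) (c : PBond (F.P K) j), (domainsOfSeq s.Ω k hkk).LamBond j c →
              avgFamily (avOfRecord F 2 K) (γ t) j c = W j c) →
              ∀ a : ℝ, HasDerivAt (fun t => wilsonAction4 (γ t)) a 0 → a = 0) :
    False :=
  not_hseam F hseam

end NotInhabited

end Summit.QuantumFields.YangMills.BalabanUVNodes.N07SeamWitness

end
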